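import Summits.BirchSwinnertonDyer.BirchSwinnertonDyer.Theses.GenusKolyvaginAtTwo

/-!
# LINE 9 glue: `OffHabitatResidualAtTwoOfShift` (item stmt-BirchSwinnertonDyer-27472)

The j/shift case split: on the even-Tamagawa habitat H_ev take the shifted supply (J2), universal
2^s-divisibility for s ≤ t = ord₂ c(E) from Tamagawa divisibility (J1) at the concentrating prime q₀,
#Ш(E/K)[2^∞] = 2^(2(M₀ − t)) from shifted exactness (J3), BSD₂ of the rank-1 twin from the declared
residual (R′, the twin is non-CM of analytic rank 1), then the shifted exact descent (J4); off H_ev the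
residual R′ applies directly. Pure logic; no summit, rung or crux is proved here.
-/

namespace Summit.BirchSwinnertonDyer.BirchSwinnertonDyer.Theses.GenusKolyvaginAtTwo

/-- LINE 9 glue (item stmt-BirchSwinnertonDyer-27472): the children J1 `TamagawaDivisibilityAtTwo`,
J2 `ShiftedGenusSupplyAtTwo`, J3 `KolyvaginExactAtTwoShifted`, J4 `ShiftedExactDescentAtTwo` and the
declared residual R′ `OffShiftedHabitatResidualAtTwo` imply the parent `OffHabitatResidualAtTwo`, by a
case split on the even-Tamagawa habitat H_ev. Pure logic over the route's own statements. -/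
theorem offHabitatResidualAtTwoOfShift_proof : OffHabitatResidualAtTwoOfShift := by
  unfold OffHabitatResidualAtTwoOfShift TamagawaDivisibilityAtTwo ShiftedGenusSupplyAtTwo KolyvaginExactAtTwoShifted ShiftedExactDescentAtTwo OffShiftedHabitatResidualAtTwo OffHabitatResidualAtTwo
  intro hJ1 hJ2 hJ3 hJ4 hR' W _ _ _ hcm hr hH
  by_cases hEv : (W.analyticRank = 0 ∧ (∀ n : ℕ, 0 < n → W.HasSurjectiveModNGaloisRep ((2 : ℤ) ^ n)) ∧ ¬ Odd W.tamagawaProduct ∧ ¬ 2 ∣ W.conductorNorm ℤ ∧ W.Δ < 0 ∧ (∃ (q₀ : ℕ) (_ : Fact q₀.Prime), (q₀ : ℤ) ∣ W.conductorNorm ℤ ∧ padicValNat 2 ((W.baseChange ℚ_[q₀]).localTamagawaNumber ℤ_[q₀]) = padicValNat 2 W.tamagawaProduct) ∧ ∃ Dt : Literature.NumberTheory.EllipticCurves.ModularForms.ModularParametrizationData W (W.conductorNorm ℤ), (∀ z ∈ Dt.L.lattice, ∃ w ∈ Literature.NumberTheory.EllipticCurves.ModularForms.periodLattice Dt.f,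 z = (Dt.c : ℂ) * w) ∧ Odd Dt.c)
  · obtain ⟨hr0, hρ, hTev, hN2, hΔ, hq, hopt⟩ := hEv
    obtain ⟨K, _, _, hIQ, hodd, h3, hHe, hsq1, hsq2, Dt, β, ι, d₁, hoptDt, hc, hy, M₀, hdiv, hndiv, n, d, hn, hKoly, hPn, htM, Wd, _, _, hWd, hcmd, hrd⟩ := hJ2 W hcm hr0 hρ hTev hN2 hΔ hq hopt
    obtain ⟨q₀, hq₀F, hq₀N, hq₀t⟩ := hq
    have h4 : NumberField.discr K ≠ -4 := by
      intro h; rw [h] at hodd; exact absurd hodd (by decide)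
    have hT : ∀ (s : ℕ), s ≤ padicValNat 2 W.tamagawaProduct → ∀ (n : ℕ) (d : Literature.NumberTheory.EllipticCurves.KolyvaginHeegnerData Dt β ι n), Squarefree n → (∀ ℓ ∈ n.primeFactors, Literature.NumberTheory.EllipticCurves.Zhang2014.IsKolyvaginPrime (W.conductorNorm ℤ) W K 2 ℓ ∧ s ≤ Literature.NumberTheory.EllipticCurves.Zhang2014.kolyvaginIndex W 2 ℓ) → ∃ Q : (W.baseChange (Literature.NumberTheory.EllipticCurves.ringClassField K ι n)).toAffine.Point, ((2 ^ s : ℕ) : ℤ) • Q = d.derivedPoint := by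
      intro s hs n' d' hn' hK'
      exact hJ1 W hcm hΔ K hIQ h3 h4 hHe hN2 hsq1 hsq2 hρ ⟨Dt, hoptDt⟩ Dt β ι d₁ hy q₀ hq₀N s (hq₀t ▸ hs) n' d' hn' hK'
    have hex := hJ3 W hcm hΔ K hIQ hodd h3 hHe hsq1 hsq2 hρ Dt β ι d₁ hy M₀ hdiv hndiv (padicValNat 2 W.tamagawaProduct) hT n d hn hKoly hPn
    haveI : NeZero (Wd.conductorNorm ℤ) := ⟨(Wd.conductorNorm_pos_holds).ne'⟩
    have hBd : Literature.NumberTheory.EllipticCurves.BSDp Wd 2 :=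
      hR' Wd hcmd (le_of_eq hrd) (fun h => zero_ne_one (h.1.symm.trans hrd)) (fun h => zero_ne_one (h.1.symm.trans hrd))
    exact hJ4 W hcm hr0 hρ K hIQ hodd h3 hHe Dt hoptDt hc β ι d₁ hy M₀ hdiv hndiv htM hex Wd hWd hBd
  · exact hR' W hcm hr hH hEv

end Summit.BirchSwinnertonDyer.BirchSwinnertonDyer.Theses.GenusKolyvaginAtTwo
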